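import Literature.NumberTheory.Automorphic.AdelicVectorHeight
import Literature.NumberTheory.Automorphic.AdelicGroupData
import HarnessLib

/-!
# Hadamard's inequality for adelic heights and the separation of cusps for `GL₂`
(Gelbart, *Automorphic forms on adele groups* (1975), Lemma 9.8, p. 125: "there exists `c₁ > 1`
such that `γ ∈ B_ℚ` iff `H(γ x) > log c₁` for all `x` with `H(x) > log c₁`"; Godement,
*Domaines fondamentaux des groupes arithmétiques*, Sém. Bourbaki 257, §1.1 (vi))

Topic `NumberTheory/Automorphic`; theorems only. With the tree's heights of adelic row vectors
(`vecHeight`, `AdelicVectorHeight`: sup norms at the finite places, Euclidean norms at the real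
places and their squares at the complex ones) Hadamard's inequality holds place by place with
constant `1`, whence:

* `nnnorm_det_two_snd_le`, `nnnorm_det_two_fst_le` — **local Hadamard inequalities**
  `|x₀ y₁ - x₁ y₀|_v ≤ h_v(x) h_v(y)` (ultrametric) and `‖x₀ y₁ - x₁ y₀‖_w ≤ ‖x‖_w ‖y‖_w`
  (Cauchy–Schwarz);
* `ideleNorm_det_two_le_vecHeight_mul` — **global**: `|x₀ y₁ - x₁ y₀|_𝔸 ≤ h(x) h(y)` whenever
  the determinant is an idele and `x`, `y` have finite height data;
* `det_two_vecMul` — `(ξ g)₀ (η g)₁ - (ξ g)₁ (η g)₀ = (ξ₀ η₁ - ξ₁ η₀) det g`;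
* `ideleNorm_det_le_vecHeight_vecMul_mul` — **separation of cusps**: for `g ∈ GL₂(𝔸_K)` and
  rational row vectors `ξ, η ∈ K²` with `ξ₀ η₁ ≠ ξ₁ η₀`,
  `|det g|_𝔸 ≤ h(ξ g) · h(η g)` (product formula for the rational determinant). With
  Gelbart's `e^{-2H(x)} = h(e₂ x)² / |det x|_𝔸` (Iwasawa `x = n a k`: `h(e₂ x) = |a₂|`) and
  `e₂ γ`, `e₂` independent exactly when `γ ∉ B(K)`, this is Lemma 9.8 in the sharp form
  **`H(γ x) + H(x) ≤ 0` for `γ ∈ GL₂(K) ∖ B(K)`** (`c₁ = 1`): a rational element not in the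
  Borel subgroup never maps a point high in the cusp to a point high in the cusp.

## References

* S. Gelbart, *Automorphic forms on adele groups*, Ann. of Math. Studies 83 (1975), Lemma 9.8
  [Gelbart1975].
* P. Garrett, *Modern Analysis of Automorphic Forms by Example* (2018), §2.2 [Garrett2018].
-/

noncomputable section

open scoped NNReal Matrix
open NumberField IsDedekindDomain

namespace Literature.NumberTheory.Automorphic

variable (K : Type) [Field K] [NumberField K]

/-! ### Local Hadamard inequalities -/

/-- **Hadamard at a finite place** (ultrametric): `|x₀ y₁ - x₁ y₀|_v ≤ h_v(x) h_v(y)`. [folklore] -/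
theorem nnnorm_det_two_snd_le (v : HeightOneSpectrum (𝓞 K)) (x y : Fin 2 → AdeleRing (𝓞 K) K) :
    ‖(x 0 * y 1 - x 1 * y 0).2 v‖₊ ≤ vecFinHeight K v x * vecFinHeight K v y := by
  have hx0 := nnnorm_snd_apply_le_vecFinHeight v x 0
  have hx1 := nnnorm_snd_apply_le_vecFinHeight v x 1
  have hy0 := nnnorm_snd_apply_le_vecFinHeight v y 0
  have hy1 := nnnorm_snd_apply_le_vecFinHeight v y 1
  change ‖AdelicGroupData.adeleEval K v (x 0 * y 1 - x 1 * y 0)‖₊ ≤ _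
  rw [map_sub, map_mul, map_mul]
  simp only [AdelicGroupData.adeleEval_apply]
  rw [sub_eq_add_neg]
  refine (IsUltrametricDist.nnnorm_add_le_max _ _).trans (max_le ?_ ?_)
  · rw [nnnorm_mul]; exact mul_le_mul' hx0 hy1
  · rw [nnnorm_neg, nnnorm_mul]; exact mul_le_mul' hx1 hy0

/-- Cauchy–Schwarz for two non-negative pairs: `p q + r s ≤ √(p² + r²) √(q² + s²)`. [folklore] -/
theorem mul_add_mul_le_sqrt_mul_sqrt (p q r s : ℝ≥0) :
    p * q + r * s ≤ NNReal.sqrt (p ^ 2 + r ^ 2) * NNReal.sqrt (q ^ 2 + s ^ 2) := by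
  rw [← NNReal.sqrt_mul, ← NNReal.sqrt_sq (p * q + r * s)]
  apply NNReal.sqrt_le_sqrt.2
  have h : ((p : ℝ) * q + r * s) ^ 2 ≤ ((p : ℝ) ^ 2 + r ^ 2) * ((q : ℝ) ^ 2 + s ^ 2) := by
    nlinarith [sq_nonneg ((p : ℝ) * s - r * q), p.2, q.2, r.2, s.2]
  exact_mod_cast h

/-- **Hadamard at an infinite place** (Cauchy–Schwarz): `‖x₀ y₁ - x₁ y₀‖_w ≤ ‖x‖_w ‖y‖_w` for the
Euclidean norms. [folklore] -/
theorem nnnorm_det_two_fst_le (w : InfinitePlace K) (x y : Fin 2 → AdeleRing (𝓞 K) K) :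
    ‖(x 0 * y 1 - x 1 * y 0).1 w‖₊ ≤ vecArchNorm K w x * vecArchNorm K w y := by
  have e : (x 0 * y 1 - x 1 * y 0).1 w = (x 0).1 w * (y 1).1 w - (x 1).1 w * (y 0).1 w := rfl
  rw [e, vecArchNorm, vecArchNorm, Fin.sum_univ_two, Fin.sum_univ_two]
  calc ‖(x 0).1 w * (y 1).1 w - (x 1).1 w * (y 0).1 w‖₊
      ≤ ‖(x 0).1 w * (y 1).1 w‖₊ + ‖(x 1).1 w * (y 0).1 w‖₊ := nnnorm_sub_le _ _
    _ = ‖(x 0).1 w‖₊ * ‖(y 1).1 w‖₊ + ‖(x 1).1 w‖₊ * ‖(y 0).1 w‖₊ := by rw [nnnorm_mul, nnnorm_mul]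
    _ ≤ NNReal.sqrt (‖(x 0).1 w‖₊ ^ 2 + ‖(x 1).1 w‖₊ ^ 2) *
          NNReal.sqrt (‖(y 1).1 w‖₊ ^ 2 + ‖(y 0).1 w‖₊ ^ 2) := mul_add_mul_le_sqrt_mul_sqrt _ _ _ _
    _ = _ := by rw [add_comm (‖(y 1).1 w‖₊ ^ 2)]

/-! ### The global inequality -/

/-- **Global Hadamard inequality**: `|x₀ y₁ - x₁ y₀|_𝔸 ≤ h(x) h(y)` when the determinant `d` is an
idele and `x`, `y` have finite height data (place by place, then products; the finite local
heights and `|d|_v` are `1` for almost all `v`). [folklore] -/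
theorem ideleNorm_det_two_le_vecHeight_mul {x y : Fin 2 → AdeleRing (𝓞 K) K}
    (hx : IsHeightFinite K x) (hy : IsHeightFinite K y) (d : (AdeleRing (𝓞 K) K)ˣ)
    (hd : (d : AdeleRing (𝓞 K) K) = x 0 * y 1 - x 1 * y 0) :
    IdeleClassGroup.ideleNorm K d ≤ vecHeight K x * vecHeight K y := by
  rw [ideleNorm_apply, vecHeight, vecHeight, mul_mul_mul_comm, ← Finset.prod_mul_distrib,
    ← finprod_mul_distrib hx hy]
  refine mul_le_mul' (Finset.prod_le_prod' fun w _ => ?_) ?_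
  · rw [← mul_pow]
    exact pow_le_pow_left' (hd ▸ nnnorm_det_two_fst_le K w x y) _
  · refine finprod_le_finprod' (hasFiniteMulSupport_nnnorm K d)
      ((hx.union hy).subset (Function.mulSupport_mul _ _)) fun v => ?_
    exact hd ▸ nnnorm_det_two_snd_le K v x y

/-! ### Determinants of rational rows through `g`, and the separation of cusps -/

/-- `(ξ g)₀ (η g)₁ - (ξ g)₁ (η g)₀ = (ξ₀ η₁ - ξ₁ η₀) det g` for row vectors `ξ, η` and a `2 × 2`
matrix `g` (multiplicativity of `det` for the matrix with rows `ξ, η`). [folklore] -/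
theorem det_two_vecMul {R : Type*} [CommRing R] (ξ η : Fin 2 → R) (g : Matrix (Fin 2) (Fin 2) R) :
    (ξ ᵥ* g) 0 * (η ᵥ* g) 1 - (ξ ᵥ* g) 1 * (η ᵥ* g) 0 = (ξ 0 * η 1 - ξ 1 * η 0) * g.det := by
  simp only [Matrix.vecMul, dotProduct, Fin.sum_univ_two, Matrix.det_fin_two]
  ring

/-- A rational row vector through `g`: `ξ g = principalVec ξ ᵥ* g`. The determinant of two of them
is the principal idele `ξ₀ η₁ - ξ₁ η₀` times `det g`. [folklore] -/
theorem det_two_principalVec_vecMul (ξ η : Fin 2 → K) (g : GL (Fin 2) (AdeleRing (𝓞 K) K)) :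
    (principalVec K ξ ᵥ* (g : Matrix (Fin 2) (Fin 2) (AdeleRing (𝓞 K) K))) 0 *
        (principalVec K η ᵥ* (g : Matrix (Fin 2) (Fin 2) (AdeleRing (𝓞 K) K))) 1 -
      (principalVec K ξ ᵥ* (g : Matrix (Fin 2) (Fin 2) (AdeleRing (𝓞 K) K))) 1 *
        (principalVec K η ᵥ* (g : Matrix (Fin 2) (Fin 2) (AdeleRing (𝓞 K) K))) 0 =
      algebraMap K (AdeleRing (𝓞 K) K) (ξ 0 * η 1 - ξ 1 * η 0) *
        Matrix.GeneralLinearGroup.det g := by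
  rw [det_two_vecMul, Matrix.GeneralLinearGroup.val_det_apply]
  simp only [principalVec_apply, map_sub, map_mul]

/-- **Separation of cusps** (Gelbart (1975), Lemma 9.8 with `c₁ = 1`): for `g ∈ GL₂(𝔸_K)` and
rational rows `ξ, η` with `ξ₀ η₁ ≠ ξ₁ η₀`, `|det g|_𝔸 ≤ h(ξ g) h(η g)`. For `ξ = e₂ γ`
(`γ ∈ GL₂(K) ∖ B(K)`, i.e. `γ₁₀ ≠ 0`) and `η = e₂` this reads `e^{-2H(γ x)} e^{-2H(x)} ≥ 1` for the
height `e^{-2H(x)} = h(e₂ x)² / |det x|_𝔸`. [cite: Gelbart1975, Lemma 9.8] -/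
theorem ideleNorm_det_le_vecHeight_vecMul_mul (g : GL (Fin 2) (AdeleRing (𝓞 K) K))
    {ξ η : Fin 2 → K} (hind : ξ 0 * η 1 - ξ 1 * η 0 ≠ 0) :
    IdeleClassGroup.ideleNorm K (Matrix.GeneralLinearGroup.det g) ≤
      vecHeight K (principalVec K ξ ᵥ* (g : Matrix (Fin 2) (Fin 2) (AdeleRing (𝓞 K) K))) *
        vecHeight K (principalVec K η ᵥ* (g : Matrix (Fin 2) (Fin 2) (AdeleRing (𝓞 K) K))) := by
  classical
  have hξ : ξ ≠ 0 := by rintro rfl; exact hind (by simp)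
  have hη : η ≠ 0 := by rintro rfl; exact hind (by simp)
  set c : Kˣ := Units.mk0 _ hind with hc
  set d : (AdeleRing (𝓞 K) K)ˣ :=
    Units.map (algebraMap K (AdeleRing (𝓞 K) K) : K →* AdeleRing (𝓞 K) K) c *
      Matrix.GeneralLinearGroup.det g with hd
  have hdval : (d : AdeleRing (𝓞 K) K) =
      (principalVec K ξ ᵥ* (g : Matrix (Fin 2) (Fin 2) (AdeleRing (𝓞 K) K))) 0 *
        (principalVec K η ᵥ* (g : Matrix (Fin 2) (Fin 2) (AdeleRing (𝓞 K) K))) 1 -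
      (principalVec K ξ ᵥ* (g : Matrix (Fin 2) (Fin 2) (AdeleRing (𝓞 K) K))) 1 *
        (principalVec K η ᵥ* (g : Matrix (Fin 2) (Fin 2) (AdeleRing (𝓞 K) K))) 0 := by
    rw [det_two_principalVec_vecMul, hd, Units.val_mul, Units.coe_map, MonoidHom.coe_coe, hc,
      Units.val_mk0]
  have h := ideleNorm_det_two_le_vecHeight_mul K (isHeightFinite_principalVec_vecMul hξ g)
    (isHeightFinite_principalVec_vecMul hη g) d hdval
  rwa [hd, map_mul, ideleNorm_principal ⟨c, rfl⟩, one_mul] at h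

end Literature.NumberTheory.Automorphic
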